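import Summits.Ventures.GridStability.Models.SMIBClearingThresholdK13
import Summits.Ventures.GridStability.Bench.SMIBDeg4ARecertD2K13postD10Roa
import Literature.Computation.Certificates.CapOdeDoubletonReplay

/-!
# Bench/SMIBCctThresholdReplayGlue — line «G1cct-SMIB-THRESH-117-K»: the glue from the kernel replays and the deg-4 ROA certificate to «every clearing instant `t_cl ≤ 0.117 s` settles» (KERNEL-ONLY THRESHOLD), stated against NAMED INTERFACES

Cell `gridfusion` (LADDER-GRIDFUSION G1.SMIB / sub-rung G1-cct; lead RULING R-CCT-THRESH-SMIB-117K
2026-08-27T05:51:15Z), seat gridfusion-model-1 (box L4).  THREE COLUMNS: a kernel composition for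
MODEL M′_SMIB = «SMIB-K13post-D10» (MODELLED: classical SMIB `SMIB.K13postD10`, MV-1 + MV-P + MV-KD;
zero-power fault-on record `SMIB.K13fault (10/377)`, i.e. `ω̇ = (377/7)P_m′ − (10/7)ω` — the field of
certnum's fault-on kernel replay `CapOdeDoubletonReplay.smibK13FaultOnD…`, p501311, `D_f/M = 10/7 ⇔
D_f = 10/377`; pre-fault angle in the replay's initial interval `⊂ [0.7290, 0.7291]` around the
printed `41.77°` [cite: Kundur1994, Example 13.1]).  No number of this file is a benchmark claim.

WHAT THIS FILE DOES (box L4 of the line, delivered AHEAD of boxes L2 / L3 as a theorem whose last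
hypotheses are exactly the decls those boxes will land):
`cct_threshold_of_kernelReplay` composes
(L1) `SMIB.K13postD10_clearing_threshold` (p503187; first-swing orbit monotonicity, model-1),
(K)  certnum's FAULT-ON kernel replay `smibK13FaultOnD_final` (p501311: every solution of the
     fault-on field from the initial box has its state at `t = 117/1000` in the claim box), bridged here
     to model-1's `(SMIB.K13fault (10/377)).IsSolutionOn` (`fieldFun_smibK13FaultOnDField`,
     `faultOn_end_mem_box`),
(ROA) the hypothesis-free deg-4 ROA `Bench.SMIB.deg4_A_recertD2_K13postD10_K13postD10_roa` (p480553),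
with THREE NAMED INTERFACES taken as hypotheses:
(L2-field) `hfield` — the post-fault replay's code-list field IS `SMIB.K13postD10.field` in `Fin 2`
  clothes: `fieldFun postField x = ![x 1, 4303847457/88791425 − 259753/4375·sin(x 0) − 10/7·x 1]`;
(L2-tube) `htube` — along every solution of that field on `[0, T_p]` from the fault-on claim box the
  angle stays `≤ A` with `A ≤ 4` (certnum RQ-016: the per-stage a-priori boxes `W_j`);
(L2/L3-entry) `hentry` + `hW` — at a mesh time `t_K ∈ [0, T_p]` every such solution is in a rational
  box `W` (certnum's mesh-point theorem ∘ «stage box ⊂ W» decide), and `W` lies in the recast preimage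
  of `{V ≤ 49/50} ∩ {|δ − δˢ| < π}` of the deg-4 certificate (sos-3 / sos-1, L3a).
CONCLUSION: for every fault-on motion `Y` of `K13fault (10/377)` on `[0, 0.117]` from the replay's
initial angle interval with `ω(0) = 0`, and EVERY clearing instant `t′ ∈ [0, 0.117 s]`: a post-fault
solution of `K13postD10` from `Y t′` exists and EVERY one keeps `δ ∈ (−π − δˢ, π − δˢ)` for all times
and tends to `(δˢ, 0)` — «CCT(M′_SMIB) ≥ 0.117 s in THRESHOLD sense, kernel-only» once L2 / L3 supply
the four hypotheses by name (then `Bench/SMIBCctThreshold117.lean` is a 20-line instantiation).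
Trusted base when instantiated: Lean kernel only (orbit-monotonicity theorem + kernel ODE replays +
deg-4 SOS certificate); no enclosure, no float.  #19 (≥ 0.112 s, all `D_f`) and the ∘ENCLOSURE
bracket cell stand beside it, never merged.
-/

noncomputable section

open Real Set Filter Topology NonemptyInterval Matrix
open Literature.Analysis.ValidatedNumerics
open Literature.Analysis.ODE Literature.Analysis.ODE.FExpr
open Literature.Computation.Certificates.CapOdeDoubletonReplay

namespace Summit.Ventures.GridStability.Bench.SMIBCct

/-! ### The fault-on replay field is model-1's `K13fault (10/377)` -/

/-- The code-list field of certnum's fault-on replay evaluates to `(ω, 4303847457/88791425 − (10/7)ω)`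
— i.e. `δ̇ = ω`, `ω̇ = (P_m′ − D_f ω)/M` with `M = 7/377`, `D_f = 10/377`, `P_m′ = 79912287/88791425`
(`(377/7)·P_m′ = 4303847457/88791425`). [cite: Kundur1994, Example 13.1] -/
theorem fieldFun_smibK13FaultOnDField (x : Fin 2 → ℝ) :
    fieldFun smibK13FaultOnDField x =
      ![x 1, -(((10 / 7 : ℚ) : ℝ) * x 1) + ((4303847457 / 88791425 : ℚ) : ℝ)] := by
  ext i
  fin_cases i <;> rfl

/-- `Fin 2` clothes of a planar state. [folklore] -/
def toFin2 (y : ℝ × ℝ) : Fin 2 → ℝ := ![y.1, y.2]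

/-- First component of the `Fin 2` clothes = the angle. [folklore] -/
@[simp] theorem toFin2_zero (y : ℝ × ℝ) : toFin2 y 0 = y.1 := rfl

/-- Second component of the `Fin 2` clothes = the speed. [folklore] -/
@[simp] theorem toFin2_one (y : ℝ × ℝ) : toFin2 y 1 = y.2 := rfl

/-- **Bridge + fault-on kernel replay.**  Every fault-on motion `Y` of model-1's `K13fault (10/377)`
on `[0, 117/1000]` with `(Y 0).1` in the replay's initial interval and `(Y 0).2 = 0` has
`Y (117/1000)` in the replay's claim box (certnum p501311 `smibK13FaultOnD_final`, kernel-checked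
doubleton chain). [cite: Kundur1994, Example 13.1] -/
theorem faultOn_end_mem_box {Y : ℝ → ℝ × ℝ}
    (hY : (Models.SMIB.K13fault (10 / 377)).IsSolutionOn Y (Icc 0 (117 / 1000)))
    (hY0 : (Y 0).1 ∈ Icc (((420253739949835307 / 576460752303423488 : ℚ) : ℝ))
      (((840507479899670615 / 1152921504606846976 : ℚ) : ℝ)))
    (hω0 : (Y 0).2 = 0) :
    toFin2 (Y (117 / 1000)) ∈ boxSet (castBox smibK13FaultOnDInstance.final) := by
  obtain ⟨hδ, hω⟩ := Models.SMIB.K13fault_scalar hY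
  have hz : ∀ t ∈ Icc (0 : ℝ) (117 / 1000), HasDerivWithinAt (fun s => toFin2 (Y s))
      (fieldFun smibK13FaultOnDField (toFin2 (Y t))) (Icc (0 : ℝ) (117 / 1000)) t := by
    intro t ht
    rw [fieldFun_smibK13FaultOnDField]
    refine hasDerivWithinAt_pi.2 fun i => ?_
    fin_cases i
    · simpa [toFin2, Matrix.cons_val_zero, Matrix.cons_val_one, Matrix.head_cons] using hδ t ht
    · have h := hω t ht
      have h2 : ((79912287 / 88791425 : ℝ) - 10 / 377 * (fun s => (Y s).2) t) / (7 / 377) =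
          -(((10 / 7 : ℚ) : ℝ) * (Y t).2) + ((4303847457 / 88791425 : ℚ) : ℝ) := by
        push_cast
        ring
      rw [h2] at h
      simpa [toFin2, Matrix.cons_val_zero, Matrix.cons_val_one, Matrix.head_cons] using h
  have hy₀ : toFin2 (Y 0) ∈ boxSet (castBox smibK13FaultOnDBox) := by
    refine mem_boxSet_iff.mpr fun i => ?_
    fin_cases i
    · simpa [toFin2, smibK13FaultOnDBox, NonemptyInterval.mem_ratCast_iff] using hY0
    · simp [toFin2, smibK13FaultOnDBox, NonemptyInterval.mem_ratCast_iff, hω0]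
  exact smibK13FaultOnD_final hy₀ rfl hz

/-! ### The glue theorem (interfaces L2 / L3 as hypotheses) -/

/-- **«Every clearing instant `t_cl ≤ 0.117 s` settles» for M′_SMIB, KERNEL-ONLY, modulo the named
interfaces of boxes L2 / L3.**  Hypotheses, in order: the post-fault replay field identity
(`hfield`), its horizon `T_p`, an angle ceiling `A ≤ 4` valid along every replayed solution on
`[0, T_p]` from the fault-on claim box (`htube`), a mesh time `t_K ∈ [0, T_p]` and a rational box `W`
entered by every replayed solution at `t_K` (`hentry`), and `W ⊂ {V_deg4 ≤ 49/50} ∩ {|δ − δˢ| < π}`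
(`hW`).  Then for every fault-on motion `Y` of `SMIB.K13fault (10/377)` on `[0, 0.117]` from the
replay's initial angle interval (`⊂ [0.7290, 0.7291]`) with `ω(0) = 0`, and every `t′ ∈ [0, 0.117]`:
a post-fault solution of `SMIB.K13postD10` from `Y t′` exists on every `[0, S]`, and EVERY such
solution keeps `δ(s) ∈ (−π − δˢ, π − δˢ)` for all `s ≥ 0` and tends to `(δˢ, 0)`.  MODELLED: classical
SMIB, zero-power fault with `K_D = 10` in force during the fault; nothing here is about a machine or a
grid. [cite: Kundur1994, §13.1.3 and Example 13.1; SauerPai1998, §9.6.3 (9.48)] -/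
theorem cct_threshold_of_kernelReplay
    {postField : Fin 2 → FExpr 2}
    (hfield : ∀ x : Fin 2 → ℝ, fieldFun postField x =
      ![x 1, (4303847457 / 88791425 : ℝ) - (259753 / 4375 : ℝ) * Real.sin (x 0) - (10 / 7 : ℝ) * x 1])
    {Tp : ℝ} {A : ℝ} (hA : A ≤ 4)
    (htube : ∀ z : ℝ → Fin 2 → ℝ, z 0 ∈ boxSet (castBox smibK13FaultOnDInstance.final) →
      (∀ t ∈ Icc 0 Tp, HasDerivWithinAt z (fieldFun postField (z t)) (Icc 0 Tp) t) →
      ∀ t ∈ Icc 0 Tp, z t 0 ≤ A)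
    {tK : ℝ} (htK : tK ∈ Icc 0 Tp) {W : Fin 2 → NonemptyInterval ℚ}
    (hentry : ∀ z : ℝ → Fin 2 → ℝ, z 0 ∈ boxSet (castBox smibK13FaultOnDInstance.final) →
      (∀ t ∈ Icc 0 Tp, HasDerivWithinAt z (fieldFun postField (z t)) (Icc 0 Tp) t) →
      z tK ∈ boxSet (castBox W))
    (hW : ∀ y : Fin 2 → ℝ, y ∈ boxSet (castBox W) →
      SMIB.deg4_A_recertD2_K13postD10_V (Real.sin (y 0 - Models.SMIB.deltaK13))
          (1 - Real.cos (y 0 - Models.SMIB.deltaK13)) (y 1) ≤ 49 / 50 ∧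
        |y 0 - Models.SMIB.deltaK13| < π)
    {Y : ℝ → ℝ × ℝ} (hY : (Models.SMIB.K13fault (10 / 377)).IsSolutionOn Y (Icc 0 (117 / 1000)))
    (hY0 : (Y 0).1 ∈ Icc (((420253739949835307 / 576460752303423488 : ℚ) : ℝ))
      (((840507479899670615 / 1152921504606846976 : ℚ) : ℝ)))
    (hω0 : (Y 0).2 = 0) {t' : ℝ} (ht' : t' ∈ Icc (0 : ℝ) (117 / 1000)) :
    (∃ X : ℝ → ℝ × ℝ, X 0 = Y t' ∧ ∀ S : ℝ, Models.SMIB.K13postD10.IsSolutionOn X (Icc 0 S)) ∧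
    ∀ X : ℝ → ℝ × ℝ, X 0 = Y t' → (∀ S : ℝ, Models.SMIB.K13postD10.IsSolutionOn X (Icc 0 S)) →
      (∀ s, 0 ≤ s → (X s).1 ∈ Ioo (-π - Models.SMIB.deltaK13) (π - Models.SMIB.deltaK13)) ∧
      Tendsto X atTop (𝓝 (Models.SMIB.deltaK13, 0)) := by
  -- the post-fault flow line from the clearing state at T = 117/1000
  set p := Models.SMIB.K13postD10.toLit with hp
  have hpv : p = ⟨7 / 377, 10 / 377, 79912287 / 88791425, 689 / 625⟩ := Models.SMIB.K13postD10_toLit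
  have hM : 0 < p.M := by rw [hpv]; norm_num
  set yT : ℝ × ℝ := Y (117 / 1000) with hyT
  set X₂ : ℝ → ℝ × ℝ := Models.SMIBOrbit.flow p hM yT with hX₂
  have hX₂0 : X₂ 0 = yT := Models.SMIBOrbit.flow_zero hM yT
  have hX₂sol : ∀ S : ℝ, Models.SMIB.K13postD10.IsSolutionOn X₂ (Icc 0 S) := fun S =>
    (Models.SMIB.isSolutionOn_iff_toLit Models.SMIB.K13postD10_γ X₂ _).2
      (Models.SMIBOrbit.flow_isSolution hM yT S)
  have hX₂d : ∀ t, HasDerivAt X₂ (p.vectorField (X₂ t)) t := Models.SMIBOrbit.hasDerivAt_flow hM yT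
  -- X₂ in Fin-2 clothes solves the replay field
  have hz₂ : ∀ t ∈ Icc 0 Tp, HasDerivWithinAt (fun s => toFin2 (X₂ s))
      (fieldFun postField (toFin2 (X₂ t))) (Icc 0 Tp) t := by
    intro t _
    rw [hfield]
    refine (hasDerivWithinAt_pi.2 fun i => ?_)
    fin_cases i
    · have h := ((hX₂d t).hasFDerivAt.fst).hasDerivAt
      simpa [toFin2, Matrix.cons_val_zero, Matrix.cons_val_one, Matrix.head_cons,
        Literature.MathematicalPhysics.PowerSystems.SMIB.vectorField] using h.hasDerivWithinAt
    · have h := ((hX₂d t).hasFDerivAt.snd).hasDerivAt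
      have h2 : (p.vectorField (X₂ t)).2 = (4303847457 / 88791425 : ℝ) -
          (259753 / 4375 : ℝ) * Real.sin ((X₂ t).1) - (10 / 7 : ℝ) * (X₂ t).2 := by
        rw [hpv]
        simp only [Literature.MathematicalPhysics.PowerSystems.SMIB.vectorField,
          Literature.MathematicalPhysics.PowerSystems.SMIB.accel]
        ring
      have h3 : HasDerivAt (fun s => (X₂ s).2) ((p.vectorField (X₂ t)).2) t := by simpa using h
      rw [h2] at h3
      simpa [toFin2, Matrix.cons_val_zero, Matrix.cons_val_one, Matrix.head_cons]
        using h3.hasDerivWithinAt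
  have hz₂0 : toFin2 (X₂ 0) ∈ boxSet (castBox smibK13FaultOnDInstance.final) := by
    rw [hX₂0]
    exact faultOn_end_mem_box hY hY0 hω0
  -- angle ceiling on [0, T_p] and well entry at t_K
  have hceil : ∀ t ∈ Icc 0 Tp, (X₂ t).1 ≤ A := fun t ht => by
    simpa [toFin2] using htube (fun s => toFin2 (X₂ s)) hz₂0 hz₂ t ht
  obtain ⟨hVK, huK⟩ : SMIB.deg4_A_recertD2_K13postD10_V (Real.sin ((X₂ tK).1 - Models.SMIB.deltaK13))
      (1 - Real.cos ((X₂ tK).1 - Models.SMIB.deltaK13)) (X₂ tK).2 ≤ 49 / 50 ∧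
      |(X₂ tK).1 - Models.SMIB.deltaK13| < π := by
    simpa [toFin2] using hW _ (hentry (fun s => toFin2 (X₂ s)) hz₂0 hz₂)
  -- the tail from t_K is in the deg-4 region of attraction
  have htail : Models.SMIB.K13postD10.IsSolutionOn (fun s => X₂ (tK + s)) (Ici 0) := by
    intro s _
    have h := (hX₂d (tK + s)).comp_const_add tK s
    rw [Models.SMIB.toLit_vectorField Models.SMIB.K13postD10_γ] at h
    exact h.hasDerivWithinAt
  have hlevel : (49 / 50 : ℝ) ≤ SMIB.deg4_A_recertD2_K13postD10_level := by
    simp [SMIB.deg4_A_recertD2_K13postD10_level]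
  obtain ⟨hinv, hlim⟩ := SMIB.deg4_A_recertD2_K13postD10_K13postD10_roa (x := fun s => X₂ (tK + s))
    (by norm_num) hlevel htail (by simpa using hVK) (by simpa using huK)
  -- hypotheses of the threshold theorem for X₂
  have hδs := Models.SMIB.deltaK13_lt_pi_div_two
  have hwin₂ : ∀ s, 0 ≤ s → (X₂ s).1 < Models.SMIB.deltaK13 + π := by
    intro s hs
    rcases le_or_gt s tK with hle | hgt
    · have h := hceil s ⟨hs, hle.trans htK.2⟩
      have hg := Models.SMIB.deltaK13_gt
      have hπ := Real.pi_gt_d2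
      norm_num at hg hπ
      linarith
    · have h := (hinv (s - tK) (by linarith)).2
      rw [show tK + (s - tK) = s by ring] at h
      have := (abs_lt.1 h).2
      linarith
  have hlim₂ : Tendsto X₂ atTop (𝓝 (Models.SMIB.deltaK13, 0)) := by
    have hfun : X₂ = fun s => (fun r => X₂ (tK + r)) (s + -tK) := by
      funext s; simp
    rw [hfun]
    exact hlim.comp (tendsto_atTop_add_const_right _ _ tendsto_id)
  -- the threshold theorem
  have hδ0 : (Y 0).1 ∈ Icc (7290 / 10000 : ℝ) (7291 / 10000) := by
    obtain ⟨h1, h2⟩ := hY0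
    constructor
    · refine le_trans ?_ h1; norm_num
    · refine le_trans h2 ?_; norm_num
  exact Models.SMIB.K13postD10_clearing_threshold (Df := 10 / 377) (T := 117 / 1000) (by norm_num)
    le_rfl (by norm_num) hY hδ0 hω0 hX₂0 hX₂sol hwin₂ hlim₂ ht'

end Summit.Ventures.GridStability.Bench.SMIBCct

end
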